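import Literature.IUT.LogThetaLattice.PacketWeights
import Literature.IUT.LogVolume.ProductVolume

/-!
# Bridge: the two typings of "direct product (pre-)region" ([IUTchIII] Remark 3.1.1 (iii)) agree

abc-iut cell, layer L6, MERGE-MAP v3 §8 row **B4** (writer of the map: abc-iut-L6-t7; bridge seat
abc-iut-L6-d6). [IUTchIII] Remark 3.1.1 (iii), kurims p.95 ("a region that arises as a direct product of
compact subsets of positive measure in each of the direct summands … a direct product region"; "… of
relatively compact subsets …" a direct product PRE-region) was typed twice, independently:

* abc-iut-L6-t4, `Literature.IUT.LogThetaLattice.IsDirectProductRegion μ S` (PacketWeights.lean p403744):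
  a predicate on a SUBSET `S ⊆ Π_v M_v` together with a family of measures `μ_v` —
  `∃ T, S = Set.univ.pi T ∧ ∀ v, IsCompact (T v) ∧ 0 < μ v (T v)`;
* abc-iut-S2, `Literature.IUT.LogVolume.IntegralStructure.IsDirectProductRegion Λ A`
  (LogVolume/ProductVolume.lean p404346): a predicate on the FAMILY OF FACTORS `A_j ⊆ V_j` relative to
  integral structures `Λ_j` (normalised Haar measures `(Λ j).haar`) — `∀ j, IsCompact (A j) ∧ 0 < μ_{Λ_j}(A j)`;
and likewise for pre-regions. This proof-only companion (no statement file touched) records that on boxes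
`S = Π_j A_j` with the normalised Haar measures they coincide (`isDirectProductRegion_pi_iff`), that t4's
subset-form is exactly "∃ factors, S2's factor-form" (`isDirectProductRegion_iff_exists`), and the
pre-region analogue (`isDirectProductPreRegion_pi_of`, and the converse for boxes with nonempty factors,
`isDirectProductPreRegion_pi_iff`). The one non-formal point: a box `Π_j A_j = Π_j T_j` with all `T_j` of
positive measure has nonempty factors, so the factors are determined (`Set.eval_image_univ_pi`).
Classical; nothing here takes a side on [IUTchIII] Cor 3.12; typed ≠ discharged.
[cite: Mochizuki2012, IUTchIII Rmk. 3.1.1 (iii) p. 95]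
-/

noncomputable section

open MeasureTheory Set

namespace Literature.IUT.LogThetaLattice

universe u v

section General

variable {J : Type u} {M : J → Type v} [∀ j, TopologicalSpace (M j)] [∀ j, MeasurableSpace (M j)]

omit [∀ j, TopologicalSpace (M j)] [∀ j, MeasurableSpace (M j)] in
/-- If two boxes over `Set.univ` agree and the second has nonempty factors, the factors agree.
[cite: Mochizuki2012, IUTchIII Rmk. 3.1.1 (iii) p. 95] -/
theorem factors_eq_of_univ_pi_eq {A T : ∀ j, Set (M j)} (h : Set.univ.pi A = Set.univ.pi T)
    (hT : ∀ j, (T j).Nonempty) : A = T := by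
  have hTne : (Set.univ.pi T).Nonempty := Set.univ_pi_nonempty_iff.mpr hT
  have hAne : (Set.univ.pi A).Nonempty := by rw [h]; exact hTne
  funext j
  rw [← Set.eval_image_univ_pi (i := j) hAne, ← Set.eval_image_univ_pi (i := j) hTne, h]

/-- t4's subset-form predicate on a box with factors of positive measure reads off the factors:
`IsDirectProductRegion μ (Π A) ↔ ∀ j, IsCompact (A j) ∧ 0 < μ j (A j)`.
[cite: Mochizuki2012, IUTchIII Rmk. 3.1.1 (iii) p. 95] -/
theorem isDirectProductRegion_univ_pi_iff (μ : ∀ j, Measure (M j)) (A : ∀ j, Set (M j)) :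
    IsDirectProductRegion μ (Set.univ.pi A) ↔ ∀ j, IsCompact (A j) ∧ 0 < μ j (A j) := by
  constructor
  · rintro ⟨T, hAT, hT⟩
    have hne : ∀ j, (T j).Nonempty := fun j =>
      Set.nonempty_iff_ne_empty.mpr fun h0 => (hT j).2.ne' (by rw [h0, measure_empty])
    rw [factors_eq_of_univ_pi_eq hAT hne]
    exact hT
  · intro h
    exact ⟨A, rfl, h⟩

omit [∀ j, MeasurableSpace (M j)] in
/-- t4's pre-region predicate holds on any box with relatively compact factors.
[cite: Mochizuki2012, IUTchIII Rmk. 3.1.1 (iii) p. 95] -/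
theorem isDirectProductPreRegion_univ_pi_of (A : ∀ j, Set (M j))
    (h : ∀ j, IsCompact (closure (A j))) : IsDirectProductPreRegion (Set.univ.pi A) :=
  ⟨A, rfl, h⟩

omit [∀ j, MeasurableSpace (M j)] in
/-- … and conversely when the factors are nonempty (an empty factor makes the box `∅`, which is a
pre-region for trivial reasons whatever the other factors are).
[cite: Mochizuki2012, IUTchIII Rmk. 3.1.1 (iii) p. 95] -/
theorem isDirectProductPreRegion_univ_pi_iff (A : ∀ j, Set (M j)) (hA : ∀ j, (A j).Nonempty) :
    IsDirectProductPreRegion (Set.univ.pi A) ↔ ∀ j, IsCompact (closure (A j)) := by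
  constructor
  · rintro ⟨T, hAT, hT⟩
    have hAne : (Set.univ.pi A).Nonempty := Set.univ_pi_nonempty_iff.mpr hA
    have hTne' : (Set.univ.pi T).Nonempty := by rw [← hAT]; exact hAne
    have hTne : ∀ j, (T j).Nonempty := Set.univ_pi_nonempty_iff.mp hTne'
    rw [factors_eq_of_univ_pi_eq hAT hTne]
    exact hT
  · exact isDirectProductPreRegion_univ_pi_of A

end General

section Haar

open Literature.IUT.LogVolume

variable {J : Type u} [Fintype J] {V : J → Type v} [∀ j, AddCommGroup (V j)]
  [∀ j, TopologicalSpace (V j)] [∀ j, IsTopologicalAddGroup (V j)] [∀ j, MeasurableSpace (V j)]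
  [∀ j, BorelSpace (V j)] (Λ : ∀ j, IntegralStructure (V j))

omit [Fintype J] in
/-- **B4 bridge.** On a box `Π_j A_j`, with the normalised Haar measures of the integral structures
`Λ_j`, t4's direct-product-region predicate ([IUTchIII] Rmk 3.1.1 (iii), PacketWeights) is S2's
(LogVolume.ProductVolume). [cite: Mochizuki2012, IUTchIII Rmk. 3.1.1 (iii) p. 95] -/
theorem isDirectProductRegion_pi_iff (A : ∀ j, Set (V j)) :
    IsDirectProductRegion (fun j => (Λ j).haar) (Set.univ.pi A) ↔
      IntegralStructure.IsDirectProductRegion Λ A := by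
  rw [isDirectProductRegion_univ_pi_iff, IntegralStructure.isDirectProductRegion_iff]
  exact ⟨fun h => ⟨fun j => (h j).1, fun j => (h j).2⟩, fun h j => ⟨h.1 j, h.2 j⟩⟩

omit [Fintype J] in
/-- t4's subset-form predicate is "`S` is a box whose factors form an S2 direct product region".
[cite: Mochizuki2012, IUTchIII Rmk. 3.1.1 (iii) p. 95] -/
theorem isDirectProductRegion_iff_exists (S : Set (∀ j, V j)) :
    IsDirectProductRegion (fun j => (Λ j).haar) S ↔
      ∃ A : ∀ j, Set (V j), S = Set.univ.pi A ∧ IntegralStructure.IsDirectProductRegion Λ A := by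
  constructor
  · rintro ⟨A, rfl, hA⟩
    exact ⟨A, rfl, (isDirectProductRegion_pi_iff Λ A).mp ⟨A, rfl, hA⟩⟩
  · rintro ⟨A, rfl, hA⟩
    exact (isDirectProductRegion_pi_iff Λ A).mpr hA

omit [Fintype J] [∀ j, AddCommGroup (V j)] [∀ j, IsTopologicalAddGroup (V j)] [∀ j, MeasurableSpace (V j)]
  [∀ j, BorelSpace (V j)] in
/-- Pre-regions: S2's factor-form gives t4's subset-form on the box.
[cite: Mochizuki2012, IUTchIII Rmk. 3.1.1 (iii) p. 95] -/
theorem isDirectProductPreRegion_pi_of (A : ∀ j, Set (V j))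
    (h : IntegralStructure.IsDirectProductPreRegion A) : IsDirectProductPreRegion (Set.univ.pi A) :=
  isDirectProductPreRegion_univ_pi_of A h.isCompact_closure

omit [Fintype J] [∀ j, AddCommGroup (V j)] [∀ j, IsTopologicalAddGroup (V j)] [∀ j, MeasurableSpace (V j)]
  [∀ j, BorelSpace (V j)] in
/-- Pre-regions, boxes with nonempty factors: the two predicates coincide.
[cite: Mochizuki2012, IUTchIII Rmk. 3.1.1 (iii) p. 95] -/
theorem isDirectProductPreRegion_pi_iff (A : ∀ j, Set (V j)) (hA : ∀ j, (A j).Nonempty) :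
    IsDirectProductPreRegion (Set.univ.pi A) ↔ IntegralStructure.IsDirectProductPreRegion A := by
  rw [isDirectProductPreRegion_univ_pi_iff A hA, IntegralStructure.isDirectProductPreRegion_iff]

/-- A direct product region in t4's sense (normalised Haar measures) has box volume
`∏_j μ_{Λ_j}(A_j)` — S2's box formula transported across the bridge.
[cite: Mochizuki2012, IUTchIII Rmk. 3.1.1 (iii) p. 95] -/
theorem haar_pi_of_isDirectProductRegion [∀ j, SecondCountableTopology (V j)]
    [∀ j, LocallyCompactSpace (V j)] {S : Set (∀ j, V j)}
    (h : IsDirectProductRegion (fun j => (Λ j).haar) S) :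
    ∃ A : ∀ j, Set (V j), S = Set.univ.pi A ∧ IntegralStructure.IsDirectProductRegion Λ A ∧
      (IntegralStructure.pi Λ).haar S = ∏ j, (Λ j).haar (A j) := by
  obtain ⟨A, rfl, hA⟩ := (isDirectProductRegion_iff_exists Λ S).mp h
  exact ⟨A, rfl, hA, IntegralStructure.pi_haar_pi Λ A⟩

end Haar

end Literature.IUT.LogThetaLattice
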